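import Literature.MathematicalPhysics.QuantumFieldTheory.Balaban1983to89.B9Eq340TaxiForward

/-!
# `Balaban1983to89.B9Eq340StepLasso` — T. Bałaban, *Propagators for lattice gauge theories in a background field*, Commun. Math. Phys. **99** (1985) 389–434
# [Balaban1985BackgroundPropagators], (3.40) p. 397 with (3.3) p. 391 and (3.35) p. 396: THE LASSO OF A SIGNED STEP PATH — forward AND backward unit steps —
# is within `Σ_steps |U(∂p_step) − 1|` of `1`; and def-Y's taxicab transporter, whose origin is the block CENTRE (`embIter`), IS such a signed step path
# (the two-sided generalisation of `B9Eq340ContourLasso` ∕ `B9Eq340TaxiForward`, step F-b of the (P′1) roadmap)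

statement-level skeleton of published theorems with citation tags; proofs where landed; nothing here is a claim about the Yang–Mills mass gap

THE PRINT.  (3.40) p. 397 (transport along «a shortest contour Γ_{x,x′}»; def-Y: `Node00.OpsYTransport.parTaxiV`, each leg the shorter way round the torus);
(3.3) p. 391 (`U(Γ)`); (3.35) p. 396.

WHY THIS FILE (dag-n06-i gen 14, N06 bundle F4, row 26).  Row 26's last binder is reduced (`B9Eq3132TentPlaquettes.hP1_of_lassoSmall`) to the smallness of the
taxicab LASSOS `U(Γ_{x₀,z})·U(z,z+e_κ)·U(Γ_{x₀,z+e_κ})⁻¹` for bond pairs inside a base block, `x₀ = embIter j (src y)`.  Since `Setup.emb` is the CENTRE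
embedding, half of def-Y's legs run BACKWARD, so gen 13's forward-regime files do not apply as typed.  THIS FILE redoes the ladder bookkeeping for SIGNED unit
steps: `stepRun` (a word in `U_ν(w)` and `U_ν(w−e_ν)⁻¹`), `stepEnd`, `stepDefect κ` (the plaquette defects met when the path is translated by `e_κ`; a backward
step meets the reversed plaquette, whose defect has the same norm), `stepLasso`, and ★★★ `norm_stepLasso_sub_one_le` by induction on the steps; then a LEG of
def-Y's `taxiLegV` in EITHER regime is a signed step run (`taxiLegV_eq_stepRun`), and so is any `taxiRun` over distinct directions (`taxiRun_eq_stepRun`).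

WHAT IS PROVED (sorry-free; defs `stepRun`, `stepEnd`, `stepDefect`, `stepLasso`, `legSteps`, `taxiSteps`).
* §1 `stepRun_append`, `stepEnd_append`, `stepEnd_shift_comm`, `stepRun_cons_true/false`, ★★★ `norm_stepLasso_sub_one_le`, `stepDefect_le_of_forall` (every met
  plaquette `≤ δ` ⇒ `≤ length·δ`, with the met base points listed by `rungSites`).
* §2 `parFwdV_eq_stepRun`, `parBwdV_eq_stepRun`, `parBwdV_succ_right`, ★ `taxiLegV_eq_stepRun`, `taxiRun_congr`, `taxiRun_mul`, ★★ `taxiRun_eq_stepRun`,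
  `taxiSteps_shift` (translating start and target by `e_κ`, `κ` not a listed direction, leaves the steps unchanged).

HONEST SCOPE.  Elementary bookkeeping over def-Y's `parTaxiV`; no-wrap ∕ regime hypotheses are displayed where needed and discharged in the sequel from the geometry of
the base blocks; nothing of [B9] asserted; count-neutral; N06 NOT discharged.  Cell `pub-ymgap` (HUMAN RULING D-0062), Track A node N06 [B9], seat
`pub-ymgap-dag-n06-i` (gen 14), 2026-08-27; a NEW file.
-/

namespace Literature.MathematicalPhysics.QuantumFieldTheory.Balaban1983to89.B9Eq340StepLasso

open Finset
open T4RelativeLadder (UnitaryLike norm_conj_sub_one_eq)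
open B9BackgroundsKLevelV1 (CfgV1 shiftsV1)
open B9Eq39Adjoint (plaqU)
open Node00 (parFwdV parFwdV_succ parBwdV parBwdV_succ taxiLegV taxiRun parTaxiV iterate_shift_apply)
open B9Eq340ContourLasso (iterate_shift_shift_comm)
open B9Eq340TaxiForward (parFwdV_succ_right)
open B10StarCount (shift_unshift unshift_shift)

variable {P : Params} {𝔸 : Type} [NormedRing 𝔸]

/-! ## §1 Signed step paths and their lassos -/

/-- the torus shifts of the V1 carrier act by `x ↦ x + e_μ`. [cite: Balaban1985BackgroundPropagators, (3.1) p.390, dictionary] -/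
private theorem shiftsV1_apply' (μ : Fin P.d) (x : Site P 0) : shiftsV1 P μ x = x.shift μ := rfl

/-- the transporter along a SIGNED step path: `(ν, true)` = the bond `⟨w, w+e_ν⟩` forward (`U_ν(w)`), `(ν, false)` = the bond `⟨w−e_ν, w⟩` backward (`U_ν(w−e_ν)⁻¹`).
[cite: Balaban1985BackgroundPropagators, (3.3) p.391, (3.40) p.397] -/
def stepRun (U : CfgV1 P 𝔸) : List (Fin P.d × Bool) → Site P 0 → 𝔸ˣ
  | [], _ => 1
  | (ν, true) :: l, w => U ν w * stepRun U l (w.shift ν)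
  | (ν, false) :: l, w => (U ν (w.unshift ν))⁻¹ * stepRun U l (w.unshift ν)

/-- the endpoint of a signed step path. [cite: Balaban1985BackgroundPropagators, (3.40) p.397, bookkeeping] -/
def stepEnd : List (Fin P.d × Bool) → Site P 0 → Site P 0
  | [], w => w
  | (ν, true) :: l, w => stepEnd l (w.shift ν)
  | (ν, false) :: l, w => stepEnd l (w.unshift ν)

/-- the total plaquette defect met when the path is translated by `e_κ`: a forward `ν`-step at `w` meets `p_{νκ}(w)`, a backward one meets `p_{κν}(w − e_ν)`.
[cite: Balaban1985BackgroundPropagators, (3.35) p.396, (3.40) p.397, bookkeeping] -/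
def stepDefect (κ : Fin P.d) (U : CfgV1 P 𝔸) : List (Fin P.d × Bool) → Site P 0 → ℝ
  | [], _ => 0
  | (ν, true) :: l, w => ‖(plaqU (shiftsV1 P) U ν κ w : 𝔸) - 1‖ + stepDefect κ U l (w.shift ν)
  | (ν, false) :: l, w => ‖(plaqU (shiftsV1 P) U κ ν (w.unshift ν) : 𝔸) - 1‖ + stepDefect κ U l (w.unshift ν)

/-- the LASSO of a signed step path from `w` in the rung direction `κ`: out along the path, across `⟨z, z+e_κ⟩`, back along the translated path, and down `⟨w, w+e_κ⟩`.
[cite: Balaban1985BackgroundPropagators, (3.40) p.397, bookkeeping] -/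
def stepLasso (κ : Fin P.d) (U : CfgV1 P 𝔸) (l : List (Fin P.d × Bool)) (w : Site P 0) : 𝔸ˣ :=
  stepRun U l w * U κ (stepEnd l w) * (stepRun U l (w.shift κ))⁻¹ * (U κ w)⁻¹

/-- `stepDefect ≥ 0`. [cite: Balaban1985BackgroundPropagators, (3.35) p.396, bookkeeping] -/
theorem stepDefect_nonneg (κ : Fin P.d) (U : CfgV1 P 𝔸) : ∀ (l : List (Fin P.d × Bool)) (w : Site P 0), 0 ≤ stepDefect κ U l w
  | [], _ => le_rfl
  | (_, true) :: l, _ => add_nonneg (norm_nonneg _) (stepDefect_nonneg κ U l _)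
  | (_, false) :: l, _ => add_nonneg (norm_nonneg _) (stepDefect_nonneg κ U l _)

/-- steps concatenate. [cite: Balaban1985BackgroundPropagators, (3.3) p.391, bookkeeping] -/
theorem stepRun_append (U : CfgV1 P 𝔸) : ∀ (l₁ l₂ : List (Fin P.d × Bool)) (w : Site P 0),
    stepRun U (l₁ ++ l₂) w = stepRun U l₁ w * stepRun U l₂ (stepEnd l₁ w)
  | [], l₂, w => by simp [stepRun, stepEnd]
  | (ν, true) :: l, l₂, w => by rw [List.cons_append]; simp only [stepRun, stepEnd]; rw [stepRun_append U l l₂, mul_assoc]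
  | (ν, false) :: l, l₂, w => by rw [List.cons_append]; simp only [stepRun, stepEnd]; rw [stepRun_append U l l₂, mul_assoc]

/-- endpoints concatenate. [cite: Balaban1985BackgroundPropagators, (3.40) p.397, bookkeeping] -/
theorem stepEnd_append : ∀ (l₁ l₂ : List (Fin P.d × Bool)) (w : Site P 0), stepEnd (l₁ ++ l₂) w = stepEnd l₂ (stepEnd l₁ w)
  | [], _, _ => rfl
  | (ν, true) :: l, l₂, w => by rw [List.cons_append]; simp only [stepEnd]; exact stepEnd_append l l₂ _
  | (ν, false) :: l, l₂, w => by rw [List.cons_append]; simp only [stepEnd]; exact stepEnd_append l l₂ _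

/-- defects concatenate. [cite: Balaban1985BackgroundPropagators, (3.35) p.396, bookkeeping] -/
theorem stepDefect_append (κ : Fin P.d) (U : CfgV1 P 𝔸) : ∀ (l₁ l₂ : List (Fin P.d × Bool)) (w : Site P 0),
    stepDefect κ U (l₁ ++ l₂) w = stepDefect κ U l₁ w + stepDefect κ U l₂ (stepEnd l₁ w)
  | [], _, _ => by simp [stepDefect, stepEnd]
  | (ν, true) :: l, l₂, w => by rw [List.cons_append]; simp only [stepDefect, stepEnd]; rw [stepDefect_append κ U l l₂, add_assoc]
  | (ν, false) :: l, l₂, w => by rw [List.cons_append]; simp only [stepDefect, stepEnd]; rw [stepDefect_append κ U l l₂, add_assoc]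

/-- `(w − e_ν) + e_κ = (w + e_κ) − e_ν`. [cite: Balaban1985BackgroundPropagators, (3.1) p.390 (the torus), bookkeeping] -/
theorem unshift_shift_comm (w : Site P 0) (ν κ : Fin P.d) : (w.unshift ν).shift κ = (w.shift κ).unshift ν := by
  have h : ((w.unshift ν).shift κ).shift ν = ((w.shift κ).unshift ν).shift ν := by
    rw [Site.shift_comm, shift_unshift, shift_unshift]
  have := congrArg (fun y => y.unshift ν) h
  simpa only [unshift_shift] using this

/-- translating the start translates the end. [cite: Balaban1985BackgroundPropagators, (3.1) p.390, bookkeeping] -/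
theorem stepEnd_shift (κ : Fin P.d) : ∀ (l : List (Fin P.d × Bool)) (w : Site P 0), stepEnd l (w.shift κ) = (stepEnd l w).shift κ
  | [], _ => rfl
  | (ν, true) :: l, w => by simp only [stepEnd]; rw [← Site.shift_comm, stepEnd_shift κ l]
  | (ν, false) :: l, w => by simp only [stepEnd]; rw [← unshift_shift_comm, stepEnd_shift κ l]

/-- a signed step run of unitary-like bond variables is unitary-like. [cite: Balaban1985BackgroundPropagators, (3.40) p.397, bookkeeping] -/
theorem unitaryLike_stepRun [NormOneClass 𝔸] {U : CfgV1 P 𝔸} (hU : ∀ μ x, UnitaryLike (U μ x)) :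
    ∀ (l : List (Fin P.d × Bool)) (w : Site P 0), UnitaryLike (stepRun U l w)
  | [], _ => T4RelativeLadder.UnitaryLike.one
  | (ν, true) :: l, w => by simp only [stepRun]; exact (hU ν w).mul (unitaryLike_stepRun hU l _)
  | (ν, false) :: l, w => by simp only [stepRun]; exact (hU ν _).inv.mul (unitaryLike_stepRun hU l _)

/-- ★ **ONE MORE FORWARD STEP**: `stepLasso ((ν,true)::l) w = (F·stepLasso l (w+e_ν)·F⁻¹)·(plaquette p_{νκ}(w))`, `F = U_ν(w)`.
[cite: Balaban1985BackgroundPropagators, (3.40) p.397, bookkeeping] -/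
theorem stepLasso_cons_true (κ : Fin P.d) (U : CfgV1 P 𝔸) (ν : Fin P.d) (l : List (Fin P.d × Bool)) (w : Site P 0) :
    stepLasso κ U ((ν, true) :: l) w =
      (U ν w * stepLasso κ U l (w.shift ν) * (U ν w)⁻¹) * plaqU (shiftsV1 P) U ν κ w := by
  simp only [stepLasso, stepRun, stepEnd, plaqU, shiftsV1_apply', Site.shift_comm w κ ν, mul_inv_rev]
  group

/-- ★ **ONE MORE BACKWARD STEP**: `stepLasso ((ν,false)::l) w = (B·stepLasso l (w−e_ν)·B⁻¹)·(B·(plaquette p_{κν}(w−e_ν))·B⁻¹)`, `B = U_ν(w−e_ν)⁻¹` — the step meets the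
REVERSED plaquette, conjugated. [cite: Balaban1985BackgroundPropagators, (3.40) p.397, (3.5) p.391 (U(−∂p) = U(∂p)⁻¹), bookkeeping] -/
theorem stepLasso_cons_false (κ : Fin P.d) (U : CfgV1 P 𝔸) (ν : Fin P.d) (l : List (Fin P.d × Bool)) (w : Site P 0) :
    stepLasso κ U ((ν, false) :: l) w =
      ((U ν (w.unshift ν))⁻¹ * stepLasso κ U l (w.unshift ν) * U ν (w.unshift ν)) *
        ((U ν (w.unshift ν))⁻¹ * plaqU (shiftsV1 P) U κ ν (w.unshift ν) * U ν (w.unshift ν)) := by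
  have e1 : (w.shift κ).unshift ν = (w.unshift ν).shift κ := (unshift_shift_comm w ν κ).symm
  have e2 : (w.unshift ν).shift ν = w := shift_unshift w ν
  simp only [stepLasso, stepRun, stepEnd, plaqU, shiftsV1_apply', e1, e2, mul_inv_rev, inv_inv]
  group

/-- ★★★ **THE SIGNED LASSO IS BOUNDED BY THE PLAQUETTES IT SWEEPS**: for unitary-like bond variables, `‖stepLasso κ U l w − 1‖ ≤ stepDefect κ U l w`.
[cite: Balaban1985BackgroundPropagators, (3.40) p.397, (3.35) p.396; Balaban1985Averaging, (44)–(47) pp.24–25] -/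
theorem norm_stepLasso_sub_one_le [NormOneClass 𝔸] {U : CfgV1 P 𝔸} (hU : ∀ μ x, UnitaryLike (U μ x)) (κ : Fin P.d) :
    ∀ (l : List (Fin P.d × Bool)) (w : Site P 0), ‖(stepLasso κ U l w : 𝔸) - 1‖ ≤ stepDefect κ U l w
  | [], w => by simp [stepLasso, stepRun, stepEnd, stepDefect]
  | (ν, true) :: l, w => by
    rw [stepLasso_cons_true]
    have hF := hU ν w
    have hL : UnitaryLike (stepLasso κ U l (w.shift ν)) :=
      (((unitaryLike_stepRun hU l _).mul (hU κ _)).mul (unitaryLike_stepRun hU l _).inv).mul (hU κ _).inv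
    have hA : ‖((U ν w * stepLasso κ U l (w.shift ν) * (U ν w)⁻¹ : 𝔸ˣ) : 𝔸)‖ ≤ 1 := ((hF.mul hL).mul hF.inv).1
    have hconj : ‖((U ν w * stepLasso κ U l (w.shift ν) * (U ν w)⁻¹ : 𝔸ˣ) : 𝔸) - 1‖ = ‖(stepLasso κ U l (w.shift ν) : 𝔸) - 1‖ := by
      rw [Units.val_mul, Units.val_mul]; exact norm_conj_sub_one_eq hF _
    calc _ ≤ ‖((U ν w * stepLasso κ U l (w.shift ν) * (U ν w)⁻¹ : 𝔸ˣ) : 𝔸) - 1‖ + ‖(plaqU (shiftsV1 P) U ν κ w : 𝔸) - 1‖ :=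
          B9Eq340LadderHolonomy.norm_mul_sub_one_le hA
      _ ≤ stepDefect κ U l (w.shift ν) + ‖(plaqU (shiftsV1 P) U ν κ w : 𝔸) - 1‖ := by rw [hconj]; exact add_le_add (norm_stepLasso_sub_one_le hU κ l _) le_rfl
      _ = stepDefect κ U ((ν, true) :: l) w := by simp only [stepDefect]; ring
  | (ν, false) :: l, w => by
    rw [stepLasso_cons_false]
    have hB := (hU ν (w.unshift ν)).inv
    have hL : UnitaryLike (stepLasso κ U l (w.unshift ν)) :=
      (((unitaryLike_stepRun hU l _).mul (hU κ _)).mul (unitaryLike_stepRun hU l _).inv).mul (hU κ _).inv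
    have hA : ‖(((U ν (w.unshift ν))⁻¹ * stepLasso κ U l (w.unshift ν) * U ν (w.unshift ν) : 𝔸ˣ) : 𝔸)‖ ≤ 1 := by
      have := ((hB.mul hL).mul (hU ν (w.unshift ν))).1; simpa using this
    have hconj : ‖(((U ν (w.unshift ν))⁻¹ * stepLasso κ U l (w.unshift ν) * U ν (w.unshift ν) : 𝔸ˣ) : 𝔸) - 1‖ = ‖(stepLasso κ U l (w.unshift ν) : 𝔸) - 1‖ := by
      have := norm_conj_sub_one_eq hB (stepLasso κ U l (w.unshift ν) : 𝔸)
      rw [inv_inv] at this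
      rw [Units.val_mul, Units.val_mul]; exact this
    have hconj' : ‖(((U ν (w.unshift ν))⁻¹ * plaqU (shiftsV1 P) U κ ν (w.unshift ν) * U ν (w.unshift ν) : 𝔸ˣ) : 𝔸) - 1‖ =
        ‖(plaqU (shiftsV1 P) U κ ν (w.unshift ν) : 𝔸) - 1‖ := by
      have := norm_conj_sub_one_eq hB (plaqU (shiftsV1 P) U κ ν (w.unshift ν) : 𝔸)
      rw [inv_inv] at this
      rw [Units.val_mul, Units.val_mul]; exact this
    calc _ ≤ ‖(((U ν (w.unshift ν))⁻¹ * stepLasso κ U l (w.unshift ν) * U ν (w.unshift ν) : 𝔸ˣ) : 𝔸) - 1‖ +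
          ‖(((U ν (w.unshift ν))⁻¹ * plaqU (shiftsV1 P) U κ ν (w.unshift ν) * U ν (w.unshift ν) : 𝔸ˣ) : 𝔸) - 1‖ :=
          B9Eq340LadderHolonomy.norm_mul_sub_one_le hA
      _ ≤ stepDefect κ U l (w.unshift ν) + ‖(plaqU (shiftsV1 P) U κ ν (w.unshift ν) : 𝔸) - 1‖ := by
          rw [hconj, hconj']; exact add_le_add (norm_stepLasso_sub_one_le hU κ l _) le_rfl
      _ = stepDefect κ U ((ν, false) :: l) w := by simp only [stepDefect]; ring

/-- the sites whose plaquettes a translated signed path meets: a forward `ν`-step at `w` lists `w`, a backward one lists `w − e_ν` (with the step direction).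
[cite: Balaban1985BackgroundPropagators, (3.40) p.397, bookkeeping] -/
def rungSites : List (Fin P.d × Bool) → Site P 0 → List (Site P 0 × Fin P.d × Bool)
  | [], _ => []
  | (ν, true) :: l, w => (w, ν, true) :: rungSites l (w.shift ν)
  | (ν, false) :: l, w => (w.unshift ν, ν, false) :: rungSites l (w.unshift ν)

/-- `|rungSites| = |steps|`. [cite: Balaban1985BackgroundPropagators, (3.40) p.397, bookkeeping] -/
theorem length_rungSites : ∀ (l : List (Fin P.d × Bool)) (w : Site P 0), (rungSites l w).length = l.length
  | [], _ => rfl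
  | (ν, true) :: l, w => by simp only [rungSites, List.length_cons, length_rungSites l]
  | (ν, false) :: l, w => by simp only [rungSites, List.length_cons, length_rungSites l]

/-- ★ **UNIFORM BOUND FROM THE MET PLAQUETTES**: if every met plaquette (`p_{νκ}(v)` for forward rungs, `p_{κν}(v)` for backward rungs, `v ∈ rungSites`) is within `δ` of `1`,
then `stepDefect ≤ |steps|·δ`. [cite: Balaban1985BackgroundPropagators, (3.35) p.396, (3.40) p.397] -/
theorem stepDefect_le_of_forall (κ : Fin P.d) (U : CfgV1 P 𝔸) {δ : ℝ} :
    ∀ (l : List (Fin P.d × Bool)) (w : Site P 0),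
      (∀ r ∈ rungSites l w, ‖(plaqU (shiftsV1 P) U (if r.2.2 then r.2.1 else κ) (if r.2.2 then κ else r.2.1) r.1 : 𝔸) - 1‖ ≤ δ) →
        stepDefect κ U l w ≤ l.length * δ
  | [], _, _ => by simp [stepDefect]
  | (ν, true) :: l, w, h => by
    simp only [stepDefect, List.length_cons, Nat.cast_succ]
    have h1 : ‖(plaqU (shiftsV1 P) U ν κ w : 𝔸) - 1‖ ≤ δ := by simpa using h (w, ν, true) (by simp [rungSites])
    have h2 := stepDefect_le_of_forall κ U l (w.shift ν) fun r hr => h r (by simp [rungSites, hr])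
    linarith
  | (ν, false) :: l, w, h => by
    simp only [stepDefect, List.length_cons, Nat.cast_succ]
    have h1 : ‖(plaqU (shiftsV1 P) U κ ν (w.unshift ν) : 𝔸) - 1‖ ≤ δ := by simpa using h (w.unshift ν, ν, false) (by simp [rungSites])
    have h2 := stepDefect_le_of_forall κ U l (w.unshift ν) fun r hr => h r (by simp [rungSites, hr])
    linarith

/-! ## §2 def-Y's taxicab transporter is a signed step run (either regime, each leg) -/

/-- the signed steps of ONE leg in direction `ν` from the coordinate `c` to the coordinate `t`, the shorter way round (def-Y's `taxiLegV` decision).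
[cite: Balaban1985BackgroundPropagators, (3.40) p.397 («a shortest contour»)] -/
def legSteps (ν : Fin P.d) (c t : ZMod (P.sitesPerDir 0)) : List (Fin P.d × Bool) :=
  if (t - c).val ≤ (c - t).val then List.replicate (t - c).val (ν, true) else List.replicate (c - t).val (ν, false)

/-- the signed steps of the legs `l` from `p` towards `z` (each leg reads the START's coordinate in its own direction — legs in other directions do not move it).
[cite: Balaban1985BackgroundPropagators, (3.40) p.397, bookkeeping] -/
def taxiSteps : List (Fin P.d) → Site P 0 → Site P 0 → List (Fin P.d × Bool)
  | [], _, _ => []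
  | ν :: l, p, z => legSteps ν (p ν) (z ν) ++ taxiSteps l p z

/-- a forward straight leg is a run of forward steps. [cite: Balaban1985BackgroundPropagators, (3.3) p.391, bookkeeping] -/
theorem stepRun_replicate_true (U : CfgV1 P 𝔸) (ν : Fin P.d) : ∀ (n : ℕ) (w : Site P 0), stepRun U (List.replicate n (ν, true)) w = parFwdV U ν n w
  | 0, _ => rfl
  | n + 1, w => by rw [List.replicate_succ]; simp only [stepRun, parFwdV_succ]; rw [stepRun_replicate_true U ν n]

/-- its endpoint. [cite: Balaban1985BackgroundPropagators, (3.40) p.397, bookkeeping] -/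
theorem stepEnd_replicate_true (ν : Fin P.d) : ∀ (n : ℕ) (w : Site P 0), stepEnd (List.replicate n (ν, true)) w = (fun y : Site P 0 => y.shift ν)^[n] w
  | 0, _ => rfl
  | n + 1, w => by rw [List.replicate_succ]; simp only [stepEnd, Function.iterate_succ_apply]; exact stepEnd_replicate_true ν n _

/-- a backward straight leg is a run of backward steps. [cite: Balaban1985BackgroundPropagators, (3.3), (3.8) pp.391–392, bookkeeping] -/
theorem stepRun_replicate_false (U : CfgV1 P 𝔸) (ν : Fin P.d) : ∀ (n : ℕ) (w : Site P 0), stepRun U (List.replicate n (ν, false)) w = parBwdV U ν n w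
  | 0, _ => rfl
  | n + 1, w => by rw [List.replicate_succ]; simp only [stepRun, parBwdV_succ]; rw [stepRun_replicate_false U ν n]

/-- its endpoint. [cite: Balaban1985BackgroundPropagators, (3.40) p.397, bookkeeping] -/
theorem stepEnd_replicate_false (ν : Fin P.d) : ∀ (n : ℕ) (w : Site P 0), stepEnd (List.replicate n (ν, false)) w = (fun y : Site P 0 => y.unshift ν)^[n] w
  | 0, _ => rfl
  | n + 1, w => by rw [List.replicate_succ]; simp only [stepEnd, Function.iterate_succ_apply]; exact stepEnd_replicate_false ν n _

/-- ★ **ONE LEG OF def-Y's TAXICAB, IN EITHER REGIME, IS A SIGNED STEP RUN.** [cite: Balaban1985BackgroundPropagators, (3.40) p.397] -/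
theorem taxiLegV_eq_stepRun (U : CfgV1 P 𝔸) (z : Site P 0) (s : Site P 0 × 𝔸ˣ) (ν : Fin P.d) :
    taxiLegV U z s ν = (stepEnd (legSteps ν (s.1 ν) (z ν)) s.1, s.2 * stepRun U (legSteps ν (s.1 ν) (z ν)) s.1) := by
  unfold taxiLegV legSteps
  split_ifs with h
  · rw [stepRun_replicate_true, stepEnd_replicate_true]
  · rw [stepRun_replicate_false, stepEnd_replicate_false]

/-- a leg does not move the other coordinates. [cite: Balaban1985BackgroundPropagators, (3.40) p.397, bookkeeping] -/
theorem stepEnd_legSteps_apply_of_ne (ν : Fin P.d) (c t : ZMod (P.sitesPerDir 0)) (w : Site P 0) {μ : Fin P.d} (hμ : μ ≠ ν) :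
    stepEnd (legSteps ν c t) w μ = w μ := by
  unfold legSteps
  split_ifs
  · rw [stepEnd_replicate_true, iterate_shift_apply, if_neg hμ]
  · rw [stepEnd_replicate_false, Node00.iterate_unshift_apply, if_neg hμ]

/-- the steps depend on the start only through its coordinates in the listed directions. [cite: Balaban1985BackgroundPropagators, (3.40) p.397, bookkeeping] -/
theorem taxiSteps_congr {l : List (Fin P.d)} {p p' z z' : Site P 0} (hp : ∀ μ ∈ l, p' μ = p μ) (hz : ∀ μ ∈ l, z' μ = z μ) :
    taxiSteps l p' z' = taxiSteps l p z := by
  induction l with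
  | nil => rfl
  | cons ν l ih =>
    simp only [taxiSteps]
    rw [hp ν (by simp), hz ν (by simp), ih (fun μ hμ => hp μ (by simp [hμ])) (fun μ hμ => hz μ (by simp [hμ]))]

/-- ★★ **A TAXICAB RUN OVER DISTINCT DIRECTIONS IS A SIGNED STEP RUN** (endpoint and transporter). [cite: Balaban1985BackgroundPropagators, (3.40) p.397] -/
theorem taxiRun_eq_stepRun (U : CfgV1 P 𝔸) (z : Site P 0) :
    ∀ (l : List (Fin P.d)), l.Nodup → ∀ s : Site P 0 × 𝔸ˣ,
      taxiRun U z l s = (stepEnd (taxiSteps l s.1 z) s.1, s.2 * stepRun U (taxiSteps l s.1 z) s.1)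
  | [], _, s => by simp [taxiRun, taxiSteps, stepRun, stepEnd]
  | ν :: l, hnd, s => by
    rw [List.nodup_cons] at hnd
    have h1 : taxiRun U z (ν :: l) s = taxiRun U z l (taxiLegV U z s ν) := rfl
    rw [h1, taxiRun_eq_stepRun U z l hnd.2, taxiLegV_eq_stepRun]
    simp only [taxiSteps]
    have hsame : taxiSteps l (stepEnd (legSteps ν (s.1 ν) (z ν)) s.1) z = taxiSteps l s.1 z :=
      taxiSteps_congr (fun μ hμ => stepEnd_legSteps_apply_of_ne ν _ _ s.1 (fun h => hnd.1 (h ▸ hμ))) (fun _ _ => rfl)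
    rw [hsame, stepEnd_append, stepRun_append, mul_assoc]

/-- ★ def-Y's `parTaxiV` as a signed step run. [cite: Balaban1985BackgroundPropagators, (3.40) p.397, (3.3) p.391] -/
theorem parTaxiV_eq_stepRun (U : CfgV1 P 𝔸) (x z : Site P 0) : parTaxiV U x z = stepRun U (taxiSteps (List.finRange P.d) x z) x := by
  unfold parTaxiV
  rw [taxiRun_eq_stepRun U z _ (List.nodup_finRange _) (x, 1), one_mul]

/-- translating start and target by `e_κ`, `κ` not among the directions, leaves the steps unchanged. [cite: Balaban1985BackgroundPropagators, (3.40) p.397, bookkeeping] -/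
theorem taxiSteps_shift {l : List (Fin P.d)} {κ : Fin P.d} (hκ : κ ∉ l) (p z : Site P 0) :
    taxiSteps l (p.shift κ) (z.shift κ) = taxiSteps l p z :=
  taxiSteps_congr (fun _ hμ => B6Ineq2142KLevelV1.shift_apply_of_ne p (fun h => hκ (h ▸ hμ))) (fun _ hμ => B6Ineq2142KLevelV1.shift_apply_of_ne z (fun h => hκ (h ▸ hμ)))

end Literature.MathematicalPhysics.QuantumFieldTheory.Balaban1983to89.B9Eq340StepLasso
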